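import Summits.CriticalPhenomena.CardyFormulaZ2.Theorems.CardyBoundaryCoulombGasHalfPlaneMarkDensityLawBoxExhaustion

/-!
# Line `Sketch` — C⁺ read along real meshes
# (crux `HalfPlaneMarkDensityLaw`, stmt-CriticalPhenomena-5661)

Support file (line `Sketch`, registered stub `stub_collinearCardy_realMesh`, crux
`Summit.CriticalPhenomena.CardyFormulaZ2.Theses.CardyBoundaryCoulombGas.HalfPlaneMarkDensityLaw`;
input of the subsequential rigidity theorem of the line).

C⁺ is the collinear half-plane Cardy law for bond-`ℤ²` at `p = 1/2` with INTEGER scale `n` and floor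
arcs `[⌊an⌋, ⌊bn⌋] × {0}`, `[⌊cn⌋, ⌊yn⌋] × {0}`:
`P_{1/2}[[⌊an⌋,⌊bn⌋]×{0} ↔ [⌊cn⌋,⌊yn⌋]×{0} in ℤ×ℕ] → F(η(a,b,c,y))` (`a < b < c < y`).
This file re-reads it along REAL meshes `δ → 0⁺` with the "continuum" arcs
`{v : v₁ = 0, A ≤ δ v₀ ≤ B} = [⌈A/δ⌉, ⌊B/δ⌋] × {0}`:

  `P_{1/2}[{A ≤ δ v₀ ≤ B} ↔ {C ≤ δ v₀ ≤ Y} in ℤ×ℕ] → F(η(A,B,C,Y))` as `δ → 0⁺` (`A < B < C < Y`).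

Proof: an `ε`-sandwich. Put `n := ⌊δ⁻¹⌋₊`, so that `δ n ≤ 1 ≤ δ (n + 1)` and hence
`|X - δ X n| ≤ |X| δ` for every real `X` (`RealMesh.key`). If `ε' n ≥ |X| + 1` for the four marks
`X ∈ {A, B, C, Y}` then (integer bookkeeping with floors)
`[⌊(A+ε')n⌋, ⌊(B-ε')n⌋] ⊆ {A ≤ δ v₀ ≤ B} ⊆ [⌊(A-ε')n⌋, ⌊(B+ε')n⌋]` and likewise for `C, Y`
(`rowIcc_subset_meshArc`, `meshArc_subset_rowIcc`), so by monotonicity of the crossing event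
`P_n(A+ε',B-ε',C+ε',Y-ε') ≤ P_δ ≤ P_n(A-ε',B+ε',C-ε',Y+ε')` eventually as `δ → 0⁺`
(`n = ⌊δ⁻¹⌋₊ → ∞`). By C⁺ the two bounds tend to `F(η(A±ε',…))`, which are `ε`-close to
`F(η(A,B,C,Y))` for small `ε'` (continuity of the cross-ratio at a strictly increasing tuple and of
`F` on `(0,1)`); the sandwich criterion over the filter `𝓝[>] 0` (`RealMesh.tendsto_of_sandwich`)
concludes.
-/

noncomputable section

namespace Summit.CriticalPhenomena.CardyFormulaZ2.Cruxes.HalfPlaneMarkDensityLaw.SketchLine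

open Set MeasureTheory Filter
open Literature.Probability.LatticeModels
open Literature.Probability.Percolation hiding cardyFunction
open Literature.Probability.RandomPlanarGeometry
open Summit.CriticalPhenomena.CardyFormulaZ2.Theorems.HalfPlaneMarkDensityLaw.Negative
open scoped Topology

namespace RealMesh

/-! ## Real-analysis bookkeeping -/

/-- An `ε`-sandwich criterion over an arbitrary filter: if for every `ε > 0` the function is
eventually squeezed between two convergent functions whose limits are `ε`-close to `L`, it converges
to `L`. [folklore] -/
theorem tendsto_of_sandwich {α : Type*} {l : Filter α} {P : α → ℝ} {L : ℝ}
    (h : ∀ ε > 0, ∃ (lo hi : α → ℝ) (ℓ₁ ℓ₂ : ℝ), Tendsto lo l (𝓝 ℓ₁) ∧ Tendsto hi l (𝓝 ℓ₂) ∧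
      L - ε < ℓ₁ ∧ ℓ₂ < L + ε ∧ ∀ᶠ x in l, lo x ≤ P x ∧ P x ≤ hi x) :
    Tendsto P l (𝓝 L) := by
  rw [Metric.tendsto_nhds]
  intro ε hε
  obtain ⟨lo, hi, ℓ₁, ℓ₂, hlo, hhi, h1, h2, hev⟩ := h ε hε
  have hl : ∀ᶠ x in l, L - ε < lo x := hlo.eventually (eventually_gt_nhds h1)
  have hh : ∀ᶠ x in l, hi x < L + ε := hhi.eventually (eventually_lt_nhds h2)
  filter_upwards [hev, hl, hh] with x hx hl hh
  rw [Real.dist_eq, abs_lt]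
  constructor <;> linarith [hx.1, hx.2]

/-- `F ∘ η` along a convergent family of tuples with strictly increasing limit converges (continuity
of the cross-ratio off its poles and of `F` on `(0,1)`). [folklore] -/
theorem tendsto_cardy_of_tendsto_marks {α : Type*} {l : Filter α} {m : α → Fin 4 → ℝ}
    {q : Fin 4 → ℝ} (hq : StrictMono q) (hm : Tendsto m l (𝓝 q)) :
    Tendsto (fun x ↦ cardyFunction (crossRatio (m x))) l (𝓝 (cardyFunction (crossRatio q))) := by
  have hη : crossRatio q ∈ Ioo (0 : ℝ) 1 := crossRatio_mem_Ioo (Or.inl hq)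
  have hF : ContinuousAt cardyFunction (crossRatio q) :=
    continuousOn_cardyFunction_Ioo.continuousAt (Ioo_mem_nhds hη.1 hη.2)
  exact hF.tendsto.comp ((BoxExhaustion.continuousAt_crossRatio
    (BoxExhaustion.crossRatio_den_ne_zero hq)).tendsto.comp hm)

/-- The shrunken marks `(A + e, B - e, C + e, Y - e) → (A, B, C, Y)` as `e → 0`. [folklore] -/
theorem tendsto_marks_inner (A B C Y : ℝ) :
    Tendsto (fun e : ℝ ↦ (![A + e, B - e, C + e, Y - e] : Fin 4 → ℝ)) (𝓝 0) (𝓝 ![A, B, C, Y]) := by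
  have hc : Continuous fun e : ℝ ↦ (![A + e, B - e, C + e, Y - e] : Fin 4 → ℝ) := by
    refine continuous_pi fun i ↦ ?_
    fin_cases i <;> simp <;> fun_prop
  simpa using hc.tendsto 0

/-- The enlarged marks `(A - e, B + e, C - e, Y + e) → (A, B, C, Y)` as `e → 0`. [folklore] -/
theorem tendsto_marks_outer (A B C Y : ℝ) :
    Tendsto (fun e : ℝ ↦ (![A - e, B + e, C - e, Y + e] : Fin 4 → ℝ)) (𝓝 0) (𝓝 ![A, B, C, Y]) := by
  have hc : Continuous fun e : ℝ ↦ (![A - e, B + e, C - e, Y + e] : Fin 4 → ℝ) := by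
    refine continuous_pi fun i ↦ ?_
    fin_cases i <;> simp <;> fun_prop
  simpa using hc.tendsto 0

/-- `n = ⌊δ⁻¹⌋₊ → ∞` as `δ → 0⁺`. [folklore] -/
theorem tendsto_floor_inv : Tendsto (fun δ : ℝ ↦ ⌊δ⁻¹⌋₊) (𝓝[>] 0) atTop :=
  tendsto_nat_floor_atTop.comp tendsto_inv_nhdsGT_zero

/-- `n = ⌊δ⁻¹⌋₊` satisfies `δ n ≤ 1 ≤ δ (n + 1)` (`δ > 0`). [folklore] -/
theorem floor_inv_bounds {δ : ℝ} (hδ : 0 < δ) :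
    δ * (⌊δ⁻¹⌋₊ : ℕ) ≤ 1 ∧ 1 ≤ δ * ((⌊δ⁻¹⌋₊ : ℕ) + 1) := by
  have h1 : ((⌊δ⁻¹⌋₊ : ℕ) : ℝ) ≤ δ⁻¹ := Nat.floor_le (inv_nonneg.2 hδ.le)
  have h2 : δ⁻¹ < (⌊δ⁻¹⌋₊ : ℕ) + 1 := Nat.lt_floor_add_one _
  have e : δ * δ⁻¹ = 1 := mul_inv_cancel₀ hδ.ne'
  constructor
  · calc δ * (⌊δ⁻¹⌋₊ : ℕ) ≤ δ * δ⁻¹ := mul_le_mul_of_nonneg_left h1 hδ.le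
      _ = 1 := e
  · calc (1 : ℝ) = δ * δ⁻¹ := e.symm
      _ ≤ δ * ((⌊δ⁻¹⌋₊ : ℕ) + 1) := mul_le_mul_of_nonneg_left h2.le hδ.le

/-- **Key inequality.** If `δ n ≤ 1 ≤ δ (n + 1)` then `|X - δ X n| ≤ |X| δ`, in the two-sided form
used below. [folklore] -/
theorem key {δ n X : ℝ} (h1 : δ * n ≤ 1) (h2 : 1 ≤ δ * (n + 1)) :
    X - |X| * δ ≤ δ * (X * n) ∧ δ * (X * n) ≤ X + |X| * δ := by
  have hs0 : 0 ≤ 1 - δ * n := by linarith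
  have hs1 : 1 - δ * n ≤ δ := by linarith
  have e : X - δ * (X * n) = X * (1 - δ * n) := by ring
  have k : |X - δ * (X * n)| ≤ |X| * δ := by
    rw [e, abs_mul, abs_of_nonneg hs0]
    exact mul_le_mul_of_nonneg_left hs1 (abs_nonneg X)
  rw [abs_le] at k
  constructor <;> linarith [k.1, k.2]

/-! ## The lattice bookkeeping: floor arcs versus continuum arcs -/

/-- INNER inclusion: `[⌊(X+e)n⌋, ⌊(X'-e)n⌋] × {0} ⊆ {v : v₁ = 0, X ≤ δ v₀ ≤ X'}` when
`δ n ≤ 1 ≤ δ (n+1)` and `e n ≥ |X| + 1, |X'| + 1`. [folklore] -/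
theorem rowIcc_subset_meshArc {δ : ℝ} (hδ : 0 < δ) {n : ℕ} (h1 : δ * n ≤ 1)
    (h2 : 1 ≤ δ * (n + 1)) {e X X' : ℝ} (hX : |X| + 1 ≤ e * n) (hX' : |X'| + 1 ≤ e * n) :
    rowIcc ⌊(X + e) * n⌋ ⌊(X' - e) * n⌋ ⊆ {v : Site 2 | v 1 = 0 ∧ X ≤ δ * v 0 ∧ δ * v 0 ≤ X'} := by
  intro v hv
  simp only [rowIcc, mem_setOf_eq] at hv ⊢
  obtain ⟨hv1, hlo, hhi⟩ := hv
  have hlo' : ((⌊(X + e) * n⌋ : ℤ) : ℝ) ≤ v 0 := by exact_mod_cast hlo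
  have hhi' : ((v 0 : ℤ) : ℝ) ≤ ⌊(X' - e) * n⌋ := by exact_mod_cast hhi
  have hf1 : (X + e) * n < ⌊(X + e) * n⌋ + 1 := Int.lt_floor_add_one _
  have hf2 : (⌊(X' - e) * n⌋ : ℝ) ≤ (X' - e) * n := Int.floor_le _
  obtain ⟨kX, -⟩ := key (X := X) h1 h2
  obtain ⟨-, kX'⟩ := key (X := X') h1 h2
  refine ⟨hv1, ?_, ?_⟩
  · have hm : X * n + |X| ≤ v 0 := by linarith
    have := mul_le_mul_of_nonneg_left hm hδ.le
    linarith
  · have hm : (v 0 : ℝ) ≤ X' * n - |X'| := by linarith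
    have := mul_le_mul_of_nonneg_left hm hδ.le
    linarith

/-- OUTER inclusion: `{v : v₁ = 0, X ≤ δ v₀ ≤ X'} ⊆ [⌊(X-e)n⌋, ⌊(X'+e)n⌋] × {0}` when
`δ n ≤ 1 ≤ δ (n+1)` and `e n ≥ |X| + 1, |X'| + 1`. [folklore] -/
theorem meshArc_subset_rowIcc {δ : ℝ} (hδ : 0 < δ) {n : ℕ} (h1 : δ * n ≤ 1)
    (h2 : 1 ≤ δ * (n + 1)) {e X X' : ℝ} (hX : |X| + 1 ≤ e * n) (hX' : |X'| + 1 ≤ e * n) :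
    {v : Site 2 | v 1 = 0 ∧ X ≤ δ * v 0 ∧ δ * v 0 ≤ X'} ⊆ rowIcc ⌊(X - e) * n⌋ ⌊(X' + e) * n⌋ := by
  intro v hv
  simp only [rowIcc, mem_setOf_eq] at hv ⊢
  obtain ⟨hv1, hlo, hhi⟩ := hv
  obtain ⟨-, kX⟩ := key (X := X) h1 h2
  obtain ⟨kX', -⟩ := key (X := X') h1 h2
  refine ⟨hv1, ?_, ?_⟩
  · have h3 : δ * (X * n - |X|) ≤ δ * v 0 := by linarith
    have h4 : X * n - |X| ≤ v 0 := le_of_mul_le_mul_left h3 hδ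
    have h5 : (⌊(X - e) * n⌋ : ℝ) ≤ v 0 := by linarith [Int.floor_le ((X - e) * n)]
    exact_mod_cast h5
  · have h3 : δ * v 0 ≤ δ * (X' * n + |X'|) := by linarith
    have h4 : (v 0 : ℝ) ≤ X' * n + |X'| := le_of_mul_le_mul_left h3 hδ
    exact Int.le_floor.2 (by linarith)

/-- The four slack conditions `|X| + 1 ≤ ε' n` hold for `n = ⌊δ⁻¹⌋₊` eventually as `δ → 0⁺`.
[folklore] -/
theorem eventually_slack (A B C Y : ℝ) {ε' : ℝ} (hε' : 0 < ε') :
    ∀ᶠ δ in 𝓝[>] (0 : ℝ), |A| + 1 ≤ ε' * (⌊δ⁻¹⌋₊ : ℕ) ∧ |B| + 1 ≤ ε' * (⌊δ⁻¹⌋₊ : ℕ) ∧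
      |C| + 1 ≤ ε' * (⌊δ⁻¹⌋₊ : ℕ) ∧ |Y| + 1 ≤ ε' * (⌊δ⁻¹⌋₊ : ℕ) := by
  obtain ⟨N₀, hN₀⟩ := exists_nat_ge ((|A| + |B| + |C| + |Y| + 1) / ε')
  filter_upwards [tendsto_floor_inv.eventually (eventually_ge_atTop N₀)] with δ hδN
  have hA := abs_nonneg A; have hB := abs_nonneg B; have hC := abs_nonneg C; have hY := abs_nonneg Y
  have h1 : (|A| + |B| + |C| + |Y| + 1) / ε' ≤ (⌊δ⁻¹⌋₊ : ℕ) := hN₀.trans (by exact_mod_cast hδN)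
  rw [div_le_iff₀ hε'] at h1
  refine ⟨?_, ?_, ?_, ?_⟩ <;> linarith

/-! ## The transfer -/

/-- **C⁺ along real meshes.** The collinear half-plane Cardy law with integer scales and floor arcs
implies the same law along real meshes `δ → 0⁺` with the continuum arcs `{A ≤ δ v₀ ≤ B}`,
`{C ≤ δ v₀ ≤ Y}`; see the module docstring. [folklore] -/
theorem tendsto_realMesh
    (hC : ∀ a b c y : ℝ, a < b → b < c → c < y →
      Tendsto (fun n : ℕ ↦ μ.real (openCrossing halfPlane (arcA a b n) (rowIcc ⌊c * n⌋ ⌊y * n⌋)))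
        atTop (𝓝 (cardyFunction (crossRatio ![a, b, c, y]))))
    {A B C Y : ℝ} (hAB : A < B) (hBC : B < C) (hCY : C < Y) :
    Tendsto (fun δ : ℝ ↦ μ.real (openCrossing halfPlane
        {v : Site 2 | v 1 = 0 ∧ A ≤ δ * v 0 ∧ δ * v 0 ≤ B}
        {v : Site 2 | v 1 = 0 ∧ C ≤ δ * v 0 ∧ δ * v 0 ≤ Y})) (𝓝[>] 0)
      (𝓝 (cardyFunction (crossRatio ![A, B, C, Y]))) := by
  have hmono : StrictMono (![A, B, C, Y] : Fin 4 → ℝ) := BoxExhaustion.strictMono_marks hAB hBC hCY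
  have hin := tendsto_cardy_of_tendsto_marks hmono (tendsto_marks_inner A B C Y)
  have hout := tendsto_cardy_of_tendsto_marks hmono (tendsto_marks_outer A B C Y)
  refine tendsto_of_sandwich fun ε hε ↦ ?_
  -- the slack `ε'`
  have hg : 0 < min (min (B - A) (C - B)) (Y - C) / 2 := by
    have := lt_min (lt_min (sub_pos.2 hAB) (sub_pos.2 hBC)) (sub_pos.2 hCY); linarith
  obtain ⟨ε', hε'0, hε'g, hε'lo, hε'hi⟩ : ∃ ε' : ℝ, 0 < ε' ∧
      ε' < min (min (B - A) (C - B)) (Y - C) / 2 ∧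
      cardyFunction (crossRatio ![A, B, C, Y]) - ε <
        cardyFunction (crossRatio ![A + ε', B - ε', C + ε', Y - ε']) ∧
      cardyFunction (crossRatio ![A - ε', B + ε', C - ε', Y + ε']) <
        cardyFunction (crossRatio ![A, B, C, Y]) + ε := by
    have hev1 := hin.eventually
      (eventually_gt_nhds (show cardyFunction (crossRatio ![A, B, C, Y]) - ε < _ by linarith))
    have hev2 := hout.eventually
      (eventually_lt_nhds (show _ < cardyFunction (crossRatio ![A, B, C, Y]) + ε by linarith))
    have hev3 : ∀ᶠ e in 𝓝 (0 : ℝ), e < min (min (B - A) (C - B)) (Y - C) / 2 :=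
      eventually_lt_nhds hg
    obtain ⟨e, ⟨⟨h1, h2⟩, h3⟩, h4⟩ :=
      ((((hev1.and hev2).and hev3).filter_mono (nhdsWithin_le_nhds (s := Ioi (0 : ℝ)))).and
        self_mem_nhdsWithin).exists
    exact ⟨e, h4, h3, h1, h2⟩
  have hg1 : min (min (B - A) (C - B)) (Y - C) ≤ B - A := (min_le_left _ _).trans (min_le_left _ _)
  have hg2 : min (min (B - A) (C - B)) (Y - C) ≤ C - B := (min_le_left _ _).trans (min_le_right _ _)
  have hg3 : min (min (B - A) (C - B)) (Y - C) ≤ Y - C := min_le_right _ _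
  -- the sandwich data
  refine ⟨_, _, _, _,
    (hC (A + ε') (B - ε') (C + ε') (Y - ε') (by linarith) (by linarith) (by linarith)).comp
      tendsto_floor_inv,
    (hC (A - ε') (B + ε') (C - ε') (Y + ε') (by linarith) (by linarith) (by linarith)).comp
      tendsto_floor_inv, hε'lo, hε'hi, ?_⟩
  filter_upwards [eventually_slack A B C Y hε'0, self_mem_nhdsWithin] with δ hs hδ
  obtain ⟨hsA, hsB, hsC, hsY⟩ := hs
  have hδ0 : 0 < δ := hδ
  obtain ⟨h1, h2⟩ := floor_inv_bounds hδ0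
  simp only [Function.comp_apply]
  constructor
  · refine measureReal_mono (openCrossing_mono Subset.rfl ?_ ?_) (measure_ne_top _ _)
    · exact rowIcc_subset_meshArc hδ0 h1 h2 hsA hsB
    · exact rowIcc_subset_meshArc hδ0 h1 h2 hsC hsY
  · refine measureReal_mono (openCrossing_mono Subset.rfl ?_ ?_) (measure_ne_top _ _)
    · exact meshArc_subset_rowIcc hδ0 h1 h2 hsA hsB
    · exact meshArc_subset_rowIcc hδ0 h1 h2 hsC hsY

end RealMesh

/-- Registered stub `stub_collinearCardy_realMesh` of line `Sketch`: C⁺ (collinear half-plane Cardy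
for bond-`ℤ²` at `p = 1/2`, integer scales, floor arcs) implies the same law read along real meshes
`δ → 0⁺` with the continuum arcs `{v : v₁ = 0, A ≤ δ v₀ ≤ B}`, `{v : v₁ = 0, C ≤ δ v₀ ≤ Y}`.
[folklore] -/
theorem stub_collinearCardy_realMesh :
    (∀ a b c y : ℝ, a < b → b < c → c < y → Tendsto (fun n : ℕ ↦ μ.real (openCrossing halfPlane
      (arcA a b n) (rowIcc ⌊c * n⌋ ⌊y * n⌋))) atTop
      (𝓝 (Literature.Probability.RandomPlanarGeometry.cardyFunction
        (Literature.Probability.RandomPlanarGeometry.crossRatio ![a, b, c, y])))) →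
    ∀ A B C Y : ℝ, A < B → B < C → C < Y → Tendsto (fun δ : ℝ ↦ μ.real (openCrossing halfPlane
      {v : Site 2 | v 1 = 0 ∧ A ≤ δ * v 0 ∧ δ * v 0 ≤ B}
      {v : Site 2 | v 1 = 0 ∧ C ≤ δ * v 0 ∧ δ * v 0 ≤ Y})) (nhdsWithin 0 (Set.Ioi 0))
      (𝓝 (Literature.Probability.RandomPlanarGeometry.cardyFunction
        (Literature.Probability.RandomPlanarGeometry.crossRatio ![A, B, C, Y]))) :=
  fun hC _ _ _ _ hAB hBC hCY ↦ RealMesh.tendsto_realMesh hC hAB hBC hCY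

end Summit.CriticalPhenomena.CardyFormulaZ2.Cruxes.HalfPlaneMarkDensityLaw.SketchLine

end
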